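import Literature.MathematicalPhysics.QuantumFieldTheory.Balaban1983to89.B13Lemma1DepTorus
import Literature.MathematicalPhysics.QuantumFieldTheory.Balaban1983to89.B13BlockGeometryTorus
import Literature.MathematicalPhysics.QuantumFieldTheory.Balaban1983to89.B13CubeSumTorus

/-!
# `Balaban1983to89.B13Lemma1BlocksTorus` — T. Bałaban, *Renormalization group approach to lattice gauge field theories.
II. Cluster expansions*, Commun. Math. Phys. **116** (1988) 1–22, doi:10.1007/bf01239022 [Balaban1988RG2Cluster]:
**Lemma 1 (1.33)–(1.36) p. 9 on the two-scale torus WITH [I]'s BLOCK GEOMETRY CONCRETE** — □₀ = □̃⁵, □̃⁴, □̃² are the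
boxes of `B13BlockGeometryTorus` around the cover cube anchored at a cube a of π_k, Y₀∖□̃⁴ = (Y∖□₀) ⊔ W with W ⊆ the
cubes of □₀∖□̃⁴, the cubes □′ ⊂ □̃² of π_j are the π_j-cubes whose π_k-block lies in □̃²; the counts «8·12³»,
«(6L)⁴L^jη», #{□₀} ≤ M⁻⁴|Y| and the □₀-data (d_k(□₀) ≤ 12⁴ − 1, ≥ 80 cubes) are then THEOREMS, no longer hypotheses

statement-level skeleton of published theorems with citation tags; proofs where landed; nothing here is a claim about
the Yang–Mills mass gap

PDF held: `paper:balaban1988-cmp116-rg-ii-cluster` (journal page = PDF page + 0); pp. 7–9 re-read this session (images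
`b2b-balaban-ref1/pages/…-p008-x2.png`, `…-p009-x2.png` + text layer); [I] pp. 257, 270, 273 from the text layer.

CITATION HEADER / WHAT IS REPRODUCED (cell `pub-ymgap`, Track A node N10 = [B13], prover seat `pub-ymgap-dag-p2`, tenth
module; a NEW LEAF over `B13Lemma1DepTorus`, `B13BlockGeometryTorus`, `B13CubeSumTorus`, nothing there modified).  p. 7 [PDF 7]:
*"exp(−(κ₁ − 1)M⁻⁴|Y₀∖□̃⁴|) exp(−κd_j(X)). (1.24) … where Y = Y₀ ∪ □₀"*; p. 8 [PDF 8]: *"We take X ∈ 𝐃_j, X ⊂ □̃². …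
over □′ ∈ π_j, □′ ⊂ □̃² … This yields (6L)⁴L^jη … The sum over Y₀ is simply a sum over subsets of the family of cubes
Δ contained in □₀∖□̃⁴. … exp(8·12³exp(−½(κ₁ − 1))) ≤ e (1.27) … Finally, the sum over □₀ can be bounded by M⁻⁴|Y|"*.
* `lemma1Printed_twoTorus_blocks` — `B13.Lemma1Printed W.toStepData c` for `W : TwoTorusStep 4 L N′` (L·N′ ≥ 12 cubes
  of π_k per direction) from `B13Lemma1DepTorus.lemma1Printed_twoTorus_dep` with: the admissible □₀ ⊂ Y indexed by
  their anchor cubes a ∈ `S0 Y` with □₀(a) = the torus image of the side-12 box around a contained in Y (`hS0Y`), the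
  Y₀-families W ∈ 𝒫(`F Y a`) with `F Y a` ⊆ the cubes of □₀(a)∖□̃⁴(a) (`hFsub`), M⁻⁴|Y₀∖□̃⁴| := #(Y∖□₀(a)) + #W in
  (1.24), the □′-families `Sq Y a j` ⊆ the cubes of π_j inside □̃²(a) (`hSq`), the (I.3.7)-chain cubes □ anchored at
  cubes of Y (`hScY`) with δ₀·dist^{(ξ)}(□′, □) ≥ δ₀M(n + 1) off the enlargement of □ by n + 1 cubes of π_j (`hdist`,
  exponent form; `cubeSum_hq_weighted`).  DISCHARGED by name:
  «8·12³» (`card_tbox0_sdiff_le`), the □₀-package (`tbox0_data`), N ≥ #(Y∖□₀), N ≥ #W (`volY0_dominates`),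
  #{□₀} ≤ M⁻⁴|Y| (a ∈ □₀(a) ⊆ Y), «(6L)⁴L^jη» (`count_6L`), d_k(□₀) ≤ 12⁴ − 1, the □′-sum ≤ 1344·(L^jη)⁻⁴
  (`cubeSum_hq_weighted` ← `B13CubeSumTorus.shell_sum_le`), #{□} ≤ M⁻⁴|Y|.  What remains is print's by-reference content only: the decomposition (1.33)
  (`h133`), per-term (1.24)/(1.30)/analyticity ([13] (3.107)–(3.108), [15] Prop. 4, [I] Sect. 3), the structural
  sub-family data `hSX`/`hSX'`/`hX0`/`hdist`, the thresholds, R8/R9, and the choice of the absolute constants of (1.36)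
  (`hC`, with d_k(□₀) ≤ 12⁴ − 1 inside exp O(1)κ₁ and O₂ = 1344).
HONEST FRAMING: a count-neutral Track-A side landing (YM-PLAN §1); NOT a discharge of node N10 (B13 group FREE at NODE
00 Stages 1–3); one finite T⁴ programme at fixed ε; Bałaban AS PRINTED with page locators; nothing continuum / OS /
mass-gap / Clay.
-/

noncomputable section

namespace Literature.MathematicalPhysics.QuantumFieldTheory.Balaban1983to89.B13Lemma1BlocksTorus

open Literature.MathematicalPhysics.QuantumFieldTheory.Balaban1983to89
open Literature.MathematicalPhysics.QuantumFieldTheory.Balaban1983to89.B13ScaleTransfer (Pt)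
open Literature.MathematicalPhysics.QuantumFieldTheory.Balaban1983to89.B16Absorption (pbox mem_pbox)
open Literature.MathematicalPhysics.QuantumFieldTheory.Balaban1983to89.TreeLengthTorus
open Literature.MathematicalPhysics.QuantumFieldTheory.Balaban1983to89.TreeLengthTorusTransfer (tcoarse)
open Literature.MathematicalPhysics.QuantumFieldTheory.Balaban1983to89.B12TreeDecay (kappa₀ K₀)
open Literature.MathematicalPhysics.QuantumFieldTheory.Balaban1983to89.B13Lemma3Torus (TwoTorusStep)
open Literature.MathematicalPhysics.QuantumFieldTheory.Balaban1983to89.B13BlockGeometryTorus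
  (card_tbox0_sdiff_le tbox0_data volY0_dominates count_6L)
open Literature.MathematicalPhysics.QuantumFieldTheory.Balaban1983to89.B13CubeSumTorus (shell_sum_le)
open Literature.MathematicalPhysics.QuantumFieldTheory.Balaban1983to89.B13Lemma1DepTorus (lemma1Printed_twoTorus_dep)

section Torus

variable {L N' : ℕ} [NeZero L] [NeZero N']

/-- **The □′-sum of p. 9 with the distance hypothesis in EXPONENT FORM** (the property of dist^{(ξ)}(□′, □) that
(1.30) uses: the exponent ½δ₀·dist^{(ξ)}(□′, □) is ≥ ½δ₀M·(n + 1) when the gap between □′ and □ is ≥ n + 1 cubes of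
π_j, and ≥ 0 — for δ₀ > 0 this is `B13CubeSumTorus.cubeSum_p9_hq`'s dist ≥ (n + 1)M, dist ≥ 0; stated on the products
δ₀·dist so that no sign hypothesis on δ₀ is carried): Σ_{□′∈Sq′} e^{−½δ₀dist(□′)} ≤ 1344·((L^j(L^k)⁻¹)⁴)⁻¹ under
δ₀M ≥ 2 log 5 (`B13CubeSumTorus.shell_sum_le`). [cite: Balaban1988RG2Cluster, p.9 (the sum over the cubes □′)] -/
theorem cubeSum_hq_weighted (L N k j : ℕ) [NeZero L] [NeZero N] (hjk : j ≤ k) (a : Pt 4) {δ₀ M : ℝ}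
    (h5 : 2 * Real.log 5 ≤ δ₀ * M) (dist : TPt 4 (L ^ (k - j) * N) → ℝ) (hdist0 : ∀ q, 0 ≤ δ₀ * dist q)
    (hdist : ∀ (n : ℕ) q, q ∉ (pbox (fun i => ((L ^ (k - j) : ℕ) : ℤ) * a i - (n + 1 : ℕ))
      (fun i => ((L ^ (k - j) : ℕ) : ℤ) * a i + 2 * ((L ^ (k - j) : ℕ) : ℤ) - 1 + (n + 1 : ℕ))).image
        (proj (L ^ (k - j) * N)) → δ₀ * M * ((n : ℝ) + 1) ≤ δ₀ * dist q)
    (Sq' : Finset (TPt 4 (L ^ (k - j) * N))) :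
    ∑ q ∈ Sq', Real.exp (-((1 / 2) * δ₀ * dist q)) ≤ 1344 * (((L : ℝ) ^ j * ((L : ℝ) ^ k)⁻¹) ^ 4)⁻¹ := by
  have hL0 : (0 : ℝ) < L := by exact_mod_cast Nat.pos_of_ne_zero (NeZero.ne L)
  have hℓ : (((L : ℝ) ^ j * ((L : ℝ) ^ k)⁻¹) ^ 4)⁻¹ = (((L ^ (k - j) : ℕ) : ℝ)) ^ 4 := by
    rw [Nat.cast_pow, ← Nat.add_sub_cancel' hjk, pow_add, Nat.add_sub_cancel' hjk, mul_inv, ← mul_assoc,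
      mul_inv_cancel₀ (pow_ne_zero _ hL0.ne'), one_mul, inv_pow, inv_inv]
  rw [hℓ]
  have hr : Real.exp (-((1 / 2) * (δ₀ * M))) ≤ 1 / 5 := by
    have h1 : Real.exp (-((1 / 2) * (δ₀ * M))) ≤ Real.exp (-Real.log 5) := Real.exp_le_exp.mpr (by linarith)
    have h2 : Real.exp (-Real.log 5) = 1 / 5 := by
      rw [Real.exp_neg, Real.exp_log (by norm_num : (0 : ℝ) < 5), one_div]
    rwa [h2] at h1
  refine (Finset.sum_le_univ_sum_of_nonneg fun q => (Real.exp_pos _).le).trans ?_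
  refine shell_sum_le (L ^ (k - j)) N a (fun q => Real.exp (-((1 / 2) * δ₀ * dist q))) (Real.exp_pos _).le hr
    (fun q => Real.exp_le_one_iff.mpr (by nlinarith [hdist0 q])) (fun n q hq => ?_)
  have h := hdist n q hq
  rw [← Real.exp_nat_mul]
  apply Real.exp_le_exp.mpr
  push_cast
  nlinarith [h]

/-- **LEMMA 1 (1.33)–(1.36) p. 9 ON THE TWO-SCALE TORUS WITH [I]'s BLOCK GEOMETRY CONCRETE.**  For
`W : TwoTorusStep 4 L N′` with L·N′ ≥ 12 cubes of π_k per direction (`hN12`): `B13.Lemma1Printed W.toStepData c`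
GIVEN (a) the decomposition (1.33) of V′_k(Y) (`h133`) into the Y-sum of the terms (1.23) — □₀ ↔ anchor cubes
a ∈ `S0 Y` whose □₀(a) = the torus image of `pbox (ā − 5) (ā + 6)` (ā = `natLift a`) lies in Y (`hS0Y`; p. 7
*"Y = Y₀ ∪ □₀"*), Y₀ ↔ W ⊆ `F Y a` ⊆ the cubes of □₀(a)∖□̃⁴(a) (`hFsub`; p. 8 *"subsets of the family of cubes Δ
contained in □₀∖□̃⁴"*), j ≤ k, □′ ∈ `Sq Y a j` ⊆ the cubes of π_j = `TPt 4 (L^{k−j}·(L·N′))` whose π_k-block lies in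
□̃²(a) (`hSq`; p. 8 *"□′ ∈ π_j, □′ ⊂ □̃²"*), X ∈ `SX Y a j □′` ⊆ the X ∋ □′ (`hSX`) — plus the (I.3.7)-type Y-sum over
□ ∈ `Sc Y`, j, □′ ∈ `Sq' Y □ j`, X ∈ `SX' Y □ j □′` ⊆ the X ∋ □′ with X₀ ⊆ Y (`hSX'`, `hX0`), the cubes □ anchored at cubes of Y (`hScY`; p. 9 *"the sum over all possible cubes □ can be bounded
by M⁻⁴|Y|"*), and dist^{(ξ)}(□′, □) any function with δ₀·dist ≥ 0 and δ₀·dist ≥ δ₀M(n + 1) off the enlargement of □ by n + 1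
cubes of π_j, i.e. when the gap to □ is ≥ n + 1 cubes (`hdist0`, `hdist` — the only property of [I]'s distance used,
in the exponent form of (1.30); no sign hypothesis on δ₀ is carried); (b) per-term analyticity and the closure of
`W.Analytic` ([folklore]); (c) **(1.24)** per term with M⁻⁴|Y₀∖□̃⁴| = #(Y∖□₀(a)) + #W (`h124`) and **(1.30)** per term
with M⁻⁴|Y∖X₀| = #(Y∖X₀) (`h130`), VERBATIM, by reference in print; (d) thresholds (… δ₀M ≥ 10e⁻¹ and ≥ 2 log 5), R8, R9; (e) the constants of (1.36) (`hC`, d_k(□₀) entered as 12⁴ − 1, O₂ = 1344).  DISCHARGED HERE BY NAME: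
«8·12³», the □₀-package (localization domain ⊆ Y, d_k ≤ 12⁴ − 1, ≥ 80 cubes), M⁻⁴|Y₀∖□̃⁴| ≥ #(Y∖□₀) and ≥ #W,
#{□₀} ≤ M⁻⁴|Y|, «(6L)⁴L^jη» (module `B13BlockGeometryTorus`); the □′-sum Σ_{□′} e^{−½δ₀dist} ≤ 1344·(L^jη)⁻⁴ and
#{□} ≤ M⁻⁴|Y| (module `B13CubeSumTorus`); and inside `lemma1Printed_twoTorus_dep` everything about tree lengths — so
EVERY geometric / counting input of pp. 7–9 is now a theorem. [cite: Balaban1988RG2Cluster, Lemma 1 pp.7–9] -/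
theorem lemma1Printed_twoTorus_blocks (W : TwoTorusStep 4 L N') (c : B13.Consts) (k : ℕ) (hN12 : 12 ≤ L * N')
    (S0 : TDom 4 (L * N') → Finset (TPt 4 (L * N')))
    (F : TDom 4 (L * N') → TPt 4 (L * N') → Finset (TPt 4 (L * N')))
    (Sq : TDom 4 (L * N') → TPt 4 (L * N') → (j : ℕ) → Finset (TPt 4 (L ^ (k - j) * (L * N'))))
    (SX : TDom 4 (L * N') → TPt 4 (L * N') → (j : ℕ) → TPt 4 (L ^ (k - j) * (L * N')) →
      Finset (TDom 4 (L ^ (k - j) * (L * N'))))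
    (T : TDom 4 (L * N') → TPt 4 (L * N') → Finset (TPt 4 (L * N')) → (j : ℕ) →
      TPt 4 (L ^ (k - j) * (L * N')) → TDom 4 (L ^ (k - j) * (L * N')) → W.Φ → ℂ)
    (Sc : TDom 4 (L * N') → Finset (TPt 4 (L * N')))
    (Sq' : TDom 4 (L * N') → TPt 4 (L * N') → (j : ℕ) → Finset (TPt 4 (L ^ (k - j) * (L * N'))))
    (SX' : TDom 4 (L * N') → TPt 4 (L * N') → (j : ℕ) → TPt 4 (L ^ (k - j) * (L * N')) →
      Finset (TDom 4 (L ^ (k - j) * (L * N'))))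
    (T' : TDom 4 (L * N') → TPt 4 (L * N') → (j : ℕ) → TPt 4 (L ^ (k - j) * (L * N')) →
      TDom 4 (L ^ (k - j) * (L * N')) → W.Φ → ℂ)
    (dist : TDom 4 (L * N') → TPt 4 (L * N') → (j : ℕ) → TPt 4 (L ^ (k - j) * (L * N')) → ℝ) {K K' : ℝ}
    (h133 : ∀ Y, W.Vp Y =
      (∑ a ∈ S0 Y, ∑ X ∈ (F Y a).powerset, ∑ j ∈ Finset.range (k + 1), ∑ q ∈ Sq Y a j,
        ∑ x ∈ SX Y a j q, T Y a X j q x) +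
      (∑ a ∈ Sc Y, ∑ j ∈ Finset.range (k + 1), ∑ q ∈ Sq' Y a j, ∑ x ∈ SX' Y a j q, T' Y a j q x))
    -- [I]'s block geometry: □₀(a) ⊂ Y, Y₀∖□̃⁴ ⊂ □₀∖□̃⁴, □′ ⊂ □̃², X ∋ □′
    (hS0Y : ∀ Y, ∀ a ∈ S0 Y,
      (pbox (fun i => natLift a i - (5 : ℕ)) (fun i => natLift a i + 1 + (5 : ℕ))).image (proj (L * N')) ⊆ Y.1)
    (hFsub : ∀ Y a, F Y a ⊆
      (pbox (fun i => natLift a i - (5 : ℕ)) (fun i => natLift a i + 1 + (5 : ℕ))).image (proj (L * N')) \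
        (pbox (fun i => natLift a i - (4 : ℕ)) (fun i => natLift a i + 1 + (4 : ℕ))).image (proj (L * N')))
    (hSq : ∀ Y, ∀ a ∈ S0 Y, ∀ j, Sq Y a j ⊆ (Finset.univ : Finset (TPt 4 (L ^ (k - j) * (L * N')))).filter
      (fun q => tcoarse (L ^ (k - j)) (L * N') q ∈
        (pbox (fun i => natLift a i - (2 : ℕ)) (fun i => natLift a i + 1 + (2 : ℕ))).image (proj (L * N'))))
    (hScY : ∀ Y, Sc Y ⊆ Y.1)
    (hdist0 : ∀ Y a j q, 0 ≤ c.δ₀ * dist Y a j q)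
    (hdist : ∀ Y a j (n : ℕ) q, q ∉ (pbox (fun i => ((L ^ (k - j) : ℕ) : ℤ) * natLift a i - (n + 1 : ℕ))
      (fun i => ((L ^ (k - j) : ℕ) : ℤ) * natLift a i + 2 * ((L ^ (k - j) : ℕ) : ℤ) - 1 + (n + 1 : ℕ))).image
        (proj (L ^ (k - j) * (L * N'))) → c.δ₀ * c.M * ((n : ℝ) + 1) ≤ c.δ₀ * dist Y a j q)
    (hSX : ∀ Y a j q, SX Y a j q ⊆ (tcubeSys 4 (L ^ (k - j) * (L * N'))).above q)
    (hSX' : ∀ Y a j q, SX' Y a j q ⊆ (tcubeSys 4 (L ^ (k - j) * (L * N'))).above q)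
    (hX0 : ∀ Y, ∀ a ∈ Sc Y, ∀ j ∈ Finset.range (k + 1), ∀ q ∈ Sq' Y a j, ∀ x ∈ SX' Y a j q,
      x.1.image (tcoarse (L ^ (k - j)) (L * N')) ⊆ Y.1)
    (hAdd : ∀ (s : Set W.Φ) (f g : W.Φ → ℂ), W.Analytic f s → W.Analytic g s → W.Analytic (f + g) s)
    (hZero : ∀ s : Set W.Φ, W.Analytic 0 s)
    (hAnT : ∀ Y, ∀ a ∈ S0 Y, ∀ X ∈ (F Y a).powerset, ∀ j ∈ Finset.range (k + 1), ∀ q ∈ Sq Y a j,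
      ∀ x ∈ SX Y a j q, W.Analytic (T Y a X j q x) (W.sp1 Y))
    (hAnT' : ∀ Y, ∀ a ∈ Sc Y, ∀ j ∈ Finset.range (k + 1), ∀ q ∈ Sq' Y a j, ∀ x ∈ SX' Y a j q,
      W.Analytic (T' Y a j q x) (W.sp1 Y))
    (hK : 0 ≤ K) (hK' : 0 ≤ K')
    (hL : 2 ≤ L) (hκ : 0 ≤ c.κ) (hδ1 : c.δ < 1) (hδκ : 1 ≤ c.δ * c.κ)
    (hκ126 : kappa₀ 64 8 ≤ c.κ) (hκ126' : kappa₀ 64 8 ≤ c.δ * c.κ)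
    (hκ₁ : 1 + 2 * Real.log (8 * 12 ^ 3) ≤ c.κ₁) (hκ₁' : 2 + 16 * Real.log 128 ≤ c.κ₁)
    (hδ₀M : 10 * Real.exp (-1) ≤ c.δ₀ * c.M) (hδ₀M5 : 2 * Real.log 5 ≤ c.δ₀ * c.M)
    (hR8 : (1 - c.δ) * c.κ ≤ (1 / 4) * (c.κ₁ - 1)) (hR9 : (1 - 2 * c.δ) * c.κ ≤ (1 / 16) * c.κ₁)
    (h124 : ∀ Y φ, φ ∈ W.sp1 Y → ∀ a ∈ S0 Y, ∀ X ∈ (F Y a).powerset, ∀ j ∈ Finset.range (k + 1), ∀ q ∈ Sq Y a j,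
      ∀ x ∈ SX Y a j q,
        ‖T Y a X j q x φ‖ ≤ K * ((L : ℝ) ^ j * ((L : ℝ) ^ k)⁻¹) ^ 5 *
          Real.exp (-(c.κ₁ - 1) *
            (((Y.1 \ (pbox (fun i => natLift a i - (5 : ℕ)) (fun i => natLift a i + 1 + (5 : ℕ))).image
              (proj (L * N'))).card : ℝ) + X.card)) *
          Real.exp (-(c.κ * torusTreeLen x.1)))
    (h130 : ∀ Y φ, φ ∈ W.sp1 Y → ∀ a ∈ Sc Y, ∀ j ∈ Finset.range (k + 1), ∀ q ∈ Sq' Y a j,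
      ∀ x ∈ SX' Y a j q,
        ‖T' Y a j q x φ‖ ≤ K' * Real.exp (-(1 / 2) * (c.δ₀ * c.M) * ((L : ℝ) ^ j * ((L : ℝ) ^ k)⁻¹)⁻¹
            - (1 / 2) * c.δ₀ * dist Y a j q) *
          Real.exp (-(c.κ₁ - 1) * ((Y.1 \ x.1.image (tcoarse (L ^ (k - j)) (L * N'))).card : ℝ)) *
          Real.exp (-(c.κ * torusTreeLen x.1)))
    (hC : K * K₀ 64 8 * (2 * (6 * (L : ℝ)) ^ 4) * Real.exp 1 * Real.exp ((1 / 8) * c.κ₁ * (12 ^ 4 - 1)) +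
        2 * (64 * K') * K₀ 64 8 * 1344 ≤
      c.E₀ * c.ε₁ * c.C₁ * c.M ^ c.q * Real.exp (c.C₂ * c.κ₁)) :
    B13.Lemma1Printed W.toStepData c := by
  -- [I]'s block geometry, discharged by name
  have hblk : ∀ Y : TDom 4 (L * N'), ∀ a ∈ S0 Y,
      (pbox (fun i => natLift a i - (5 : ℕ)) (fun i => natLift a i + 1 + (5 : ℕ))).image (proj (L * N')) ⊆ Y.1 ∧
      IsTDom ((pbox (fun i => natLift a i - (5 : ℕ)) (fun i => natLift a i + 1 + (5 : ℕ))).image (proj (L * N'))) ∧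
      torusTreeLen ((pbox (fun i => natLift a i - (5 : ℕ)) (fun i => natLift a i + 1 + (5 : ℕ))).image
        (proj (L * N'))) ≤ 12 ^ 4 - 1 ∧
      (5 : ℝ) * 2 ^ 4 ≤ ((pbox (fun i => natLift a i - (5 : ℕ)) (fun i => natLift a i + 1 + (5 : ℕ))).image
        (proj (L * N'))).card :=
    fun Y a ha => tbox0_data hN12 (natLift a) (hS0Y Y a ha)
  have hF : ∀ (Y : TDom 4 (L * N')) a, ((F Y a).card : ℝ) ≤ 8 * 12 ^ 3 := fun Y a =>
    le_trans (by exact_mod_cast Finset.card_le_card (hFsub Y a)) (card_tbox0_sdiff_le (L * N') (natLift a))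
  have hS0 : ∀ Y : TDom 4 (L * N'), (S0 Y).card ≤ Y.1.card := by
    intro Y
    refine Finset.card_le_card fun a ha => hS0Y Y a ha ?_
    refine Finset.mem_image.mpr ⟨natLift a, mem_pbox.mpr fun i => ⟨?_, ?_⟩, proj_natLift a⟩
    · push_cast; omega
    · push_cast; omega
  have hq : ∀ Y : TDom 4 (L * N'), ∀ a ∈ S0 Y, ∀ j ∈ Finset.range (k + 1),
      ((Sq Y a j).card : ℝ) * ((L : ℝ) ^ j * ((L : ℝ) ^ k)⁻¹) ^ 5 ≤
        (6 * (L : ℝ)) ^ 4 * ((L : ℝ) ^ j * ((L : ℝ) ^ k)⁻¹) := by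
    intro Y a ha j hj
    have hjk : j ≤ k := Nat.lt_succ_iff.mp (Finset.mem_range.mp hj)
    have hcard : ((Sq Y a j).card : ℝ) ≤ ((Finset.univ : Finset (TPt 4 (L ^ (k - j) * (L * N')))).filter
        (fun q => tcoarse (L ^ (k - j)) (L * N') q ∈
          (pbox (fun i => natLift a i - (2 : ℕ)) (fun i => natLift a i + 1 + (2 : ℕ))).image (proj (L * N')))).card := by
      exact_mod_cast Finset.card_le_card (hSq Y a ha j)
    exact le_trans (mul_le_mul_of_nonneg_right hcard (by positivity)) (count_6L L (L * N') k j hjk (natLift a))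
  have hq' : ∀ Y : TDom 4 (L * N'), ∀ a ∈ Sc Y, ∀ j ∈ Finset.range (k + 1),
      ∑ q ∈ Sq' Y a j, Real.exp (-((1 / 2) * c.δ₀ * dist Y a j q)) ≤
        1344 * (((L : ℝ) ^ j * ((L : ℝ) ^ k)⁻¹) ^ 4)⁻¹ :=
    fun Y a _ j hj => cubeSum_hq_weighted L (L * N') k j (Nat.lt_succ_iff.mp (Finset.mem_range.mp hj)) (natLift a)
      hδ₀M5 (dist Y a j) (hdist0 Y a j) (hdist Y a j) (Sq' Y a j)
  have hSc : ∀ Y : TDom 4 (L * N'), (Sc Y).card ≤ Y.1.card := fun Y => Finset.card_le_card (hScY Y)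
  have hO₂ : (0 : ℝ) ≤ 1344 := by norm_num
  have hd0 : (0 : ℝ) ≤ 12 ^ 4 - 1 := by norm_num
  exact lemma1Printed_twoTorus_dep W c k S0
    (fun _ a => (pbox (fun i => natLift a i - (5 : ℕ)) (fun i => natLift a i + 1 + (5 : ℕ))).image (proj (L * N')))
    F Sq SX T
    (fun Y a X => (((Y.1 \ (pbox (fun i => natLift a i - (5 : ℕ)) (fun i => natLift a i + 1 + (5 : ℕ))).image
      (proj (L * N'))).card : ℝ) + X.card))
    Sc Sq' SX' T' dist h133 hSX hSX' hX0 hAdd hZero hAnT hAnT' hK hd0 hK' hO₂ hL hκ hδ1 hδκ hκ126 hκ126' hκ₁ hκ₁'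
    hδ₀M hR8 hR9 h124 hblk (fun Y a _ X _ => (volY0_dominates Y.1 _ X).1) (fun Y a X _ => (volY0_dominates Y.1 _ X).2)
    hF hS0 hq h130 hq' hSc hC

end Torus

end Literature.MathematicalPhysics.QuantumFieldTheory.Balaban1983to89.B13Lemma1BlocksTorus
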